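import Literature.Probability.RandomPlanarGeometry.SchrammSlopeScale
import Literature.Probability.RandomPlanarGeometry.SLEPointFlowStopped
import Literature.Probability.Process.HittingFrom
import HarnessLib

/-!
# The return estimate for the SLE_κ slope: after `|w|` reaches `L₂`, a return to `|w| ≤ L` is unlikely

Topic `Probability/RandomPlanarGeometry`; theorems and three auxiliary definitions (two stopping
times and an event). Third layer of the proof of the named fact
`Literature.Probability.RandomPlanarGeometry.Schramm2001_slope_dichotomy` (`SchrammLeftPassage.lean`;
O. Schramm, *A percolation formula*, Electron. Comm. Probab. **6** (2001), proof of Thm. 2), the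
"no return" half of the transience of the slope diffusion `dw = -dW̃ + 4w du/(w² + 1)`:
Schramm's `h_{a,b}(w) = (f(w) - f(a))/(f(b) - f(a))` ("the probability that `w` will hit `b` before
hitting `a` … `h(w_u)` is a local martingale … the limit [`f(±∞)`] is finite, which shows that
`lim_{b→∞} h_{a,b}(w) > 0` for all `w > a`. Hence, the diffusion process (5) is transient"), run as
an optional stopping estimate in the original time `t` of the Loewner chain, strong-Markov-free.

Setting: `0 < κ < 8`, `z ∈ ℍ` with slope `w₀ = re z/im z`, levels `L < L₂ ≤ L₃` with `|w₀| < L₂`,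
and the localizing index `n` (`ρₙ = slePointLocTime κ z n`). With the tree's stopping times
`T_s ∧ ρₙ = sleCotArgLocTime κ z s n` (exit of `|w|` from `[0, s)`, `SLEPointFlowStopped.lean`):

* `τ = T_{L₂} ∧ ρₙ` (the slope reaches `±L₂`), the cap `C = T_{L₃} ∧ ρₙ` (`|w| ≤ L₃` on `[0, C]`),
  the **return time** `υ = sleSlopeReturnTime` = first time `≥ τ` with `|w| ≤ L` (a
  `Literature.Probability.Process.hittingFrom` of the continuous adapted gauge `|x^{ρₙ}| - L y^{ρₙ}`,
  hence a stopping time), and the **return event** `Aₙ = sleSlopeReturnEvent = {τ < C, υ ≤ C}`;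
* the martingale: by the tree's Itô step `exists_martingale_slopeFunctional` with Schramm's scale
  function `f = schrammScale κ` (`A f = 0`, `slopeGen_schrammScale`), `f(w_{t∧C}) - f(w₀) = K_t` is a
  martingale with continuous paths (`exists_martingale_schrammScale`);
* **the estimate** `measureReal_sleSlopeReturnEvent_le`:
  `P(Aₙ) ≤ 2 (f(∞) - f(L₂))/(f(∞) - f(L))`, uniformly in `n` and `L₃`. Proof: optional stopping
  between `τ` and `υ ∧ C` on the `𝓕_τ`-events `G± = {τ < C, w_τ = ±L₂}`
  (`setIntegral_stoppedValue_sub_eq_zero`): on `G₊`, `f(w_τ) - f(w_{υ∧C})` has integral `0`, is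
  `≥ f(L₂) - f(L)` on `Aₙ` (`w_υ ≤ L`) and `≥ -(f(∞) - f(L₂))` always (`|f| ≤ f(∞)`), whence
  `P(G₊ ∩ Aₙ) ≤ (f(∞) - f(L₂))/(f(∞) - f(L))`; symmetrically on `G₋`.

The passage `n → ∞`, `L₂ → ∞` and the assembly of the dichotomy are in `SchrammLeftPassageProofs.lean`.
No named facts are introduced.

## References

* O. Schramm, *A percolation formula*, Electron. Comm. Probab. 6 (2001), proof of Thm. 2 and Lemma 3.
* D. Revuz, M. Yor, *Continuous Martingales and Brownian Motion* (1999), Ch. II Thm (3.2)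
  (optional stopping), Ch. VII §3 (scale function; Prop. (3.2)/(3.5): exit probabilities
  `P_x[T_b < T_a] = (s(x) - s(a))/(s(b) - s(a))`).
-/

noncomputable section

open Set Filter MeasureTheory Complex
open _root_.Topology
open scoped NNReal ENNReal

namespace Literature.Probability.RandomPlanarGeometry

open Loewner Literature.Probability.Process Literature.Analysis.FunctionSpaces

/-! ### Monotonicity of the exit times in the level -/

namespace Loewner

/-- The exit time of `|w|` from `[0, s)` is non-decreasing in the level `s`. [folklore] -/
theorem cotArgExitTime_mono (W : ℝ≥0 → ℝ) (z : ℂ) {s₁ s₂ : ℝ} (h : s₁ ≤ s₂) :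
    cotArgExitTime W z s₁ ≤ cotArgExitTime W z s₂ := by
  unfold cotArgExitTime
  refine sInf_le_sInf (image_mono fun t ht ↦ ?_)
  exact ⟨ht.1, h.trans ht.2⟩

end Loewner

variable {κ : ℝ≥0} {z : ℂ}

/-- `T_{s₁} ∧ ρₙ ≤ T_{s₂} ∧ ρₙ` for `s₁ ≤ s₂`. [folklore] -/
theorem sleCotArgLocTime_mono_level {s₁ s₂ : ℝ} (h : s₁ ≤ s₂) (n : ℕ) (ω : ℝ≥0 → ℝ) :
    sleCotArgLocTime κ z s₁ n ω ≤ sleCotArgLocTime κ z s₂ n ω :=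
  min_le_min_right _ (cotArgExitTime_mono (sleDriving κ ω) z h)

/-- `T_s ∧ ρₙ ≤ n + 1`. [folklore] -/
theorem sleCotArgLocTime_le_succ (s : ℝ) (n : ℕ) (ω : ℝ≥0 → ℝ) :
    sleCotArgLocTime κ z s n ω ≤ (((n : ℝ≥0) + 1 : ℝ≥0) : WithTop ℝ≥0) :=
  (sleCotArgLocTime_le_locTime s n ω).trans (slePointLocTime_le n ω)

/-- `T_s ∧ ρₙ ≠ ⊤`. [folklore] -/
theorem sleCotArgLocTime_ne_top (s : ℝ) (n : ℕ) (ω : ℝ≥0 → ℝ) : sleCotArgLocTime κ z s n ω ≠ ⊤ :=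
  ne_top_of_le_ne_top WithTop.coe_ne_top (sleCotArgLocTime_le_succ s n ω)

/-- If `T_s ∧ ρₙ < ρₙ` then the exit time `T_s` is the finite value of `T_s ∧ ρₙ`. [folklore] -/
theorem cotArgExitTime_eq_of_sleCotArgLocTime_lt {s : ℝ} {n : ℕ} {ω : ℝ≥0 → ℝ}
    (h : sleCotArgLocTime κ z s n ω < slePointLocTime κ z n ω) :
    cotArgExitTime (sleDriving κ ω) z s = sleCotArgLocTime κ z s n ω := by
  change _ = min (cotArgExitTime (sleDriving κ ω) z s) (slePointLocTime κ z n ω)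
  rcases le_total (cotArgExitTime (sleDriving κ ω) z s) (slePointLocTime κ z n ω) with h1 | h1
  · rw [min_eq_left h1]
  · exfalso
    have : sleCotArgLocTime κ z s n ω = slePointLocTime κ z n ω := min_eq_right h1
    rw [this] at h
    exact lt_irrefl _ h

/-- **`|w_τ| = L₂` when `τ = T_{L₂} ∧ ρₙ < ρₙ`** (`|w₀| < L₂`): the level is reached strictly before
the localizing time, so `τ = T_{L₂}` is a genuine exit time and `|w| = L₂` there by continuity.
[folklore] -/
theorem abs_cotArg_untopA_sleCotArgLocTime (hz : 0 < z.im) {s : ℝ} (h0 : |z.re / z.im| < s) {n : ℕ}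
    {ω : ℝ≥0 → ℝ} (h : sleCotArgLocTime κ z s n ω < slePointLocTime κ z n ω) :
    |cotArg (sleDriving κ ω) z (sleCotArgLocTime κ z s n ω).untopA| = s := by
  have h0' : |cotArg (sleDriving κ ω) z 0| < s := by rwa [cotArg_sleDriving_zero κ ω hz]
  refine abs_cotArg_cotArgExitTime (continuous_sleDriving κ ω) hz h0' ?_
  rw [cotArgExitTime_eq_of_sleCotArgLocTime_lt h, WithTop.untopA_eq_untop (sleCotArgLocTime_ne_top s n ω),
    WithTop.coe_untop]

/-! ### The gauge `|x^{ρₙ}| - L y^{ρₙ}` read as `|w| ≤ L` -/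

/-- Up to `ρₙ`, the gauge is non-positive exactly when `|w_t| ≤ L`. [folklore] -/
theorem sleSlopeGauge_nonpos_iff (hz : 0 < z.im) {L : ℝ} {n : ℕ} {t : ℝ≥0} {ω : ℝ≥0 → ℝ}
    (ht : (t : WithTop ℝ≥0) ≤ slePointLocTime κ z n ω) :
    sleSlopeGauge κ z L n t ω ≤ 0 ↔ |cotArg (sleDriving κ ω) z t| ≤ L := by
  have hy := stoppedProcess_slePointIm_pos hz (σ := slePointLocTime κ z n) (fun _ ↦ le_rfl) t ω
  have hw := stopped_div_eq_cotArg hz (σ := slePointLocTime κ z n) (fun _ ↦ le_rfl) t ω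
  rw [stoppedProcess_eq_of_le ht] at hy hw
  rw [sleSlopeGauge, stoppedProcess_eq_of_le ht, stoppedProcess_eq_of_le ht,
    show (((min (t : WithTop ℝ≥0) (slePointLocTime κ z n ω)).untopA : ℝ≥0)) = t by
      rw [min_eq_left ht]; rfl] at *
  rw [← hw, abs_div, abs_of_pos hy, div_le_iff₀ hy, sub_nonpos]

/-! ### The return time `υ` and the return event `Aₙ` -/

section Times

variable (κ z)

/-- **The return time `υ`**: the first time `≥ τ = T_{L₂} ∧ ρₙ` at which `|w| ≤ L`, as the hitting
time after `τ` of `(-∞, 0]` by the gauge `|x^{ρₙ}| - L y^{ρₙ}` (valued in `WithTop ℝ≥0`; `⊤` if there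
is no such time). Revuz–Yor (1999), Ch. VII §3: the passage times `T_a` after `T_b` of the exit
problem `P_x[T_b < T_a]`. [folklore] -/
def sleSlopeReturnTime (L L₂ : ℝ) (n : ℕ) : (ℝ≥0 → ℝ) → WithTop ℝ≥0 :=
  hittingFrom (sleSlopeGauge κ z L n) (Iic 0) (sleCotArgLocTime κ z L₂ n)

/-- **`υ ∧ C`**, the return time capped by `C = T_{L₃} ∧ ρₙ`. [folklore] -/
def sleSlopeReturnLocTime (L L₂ L₃ : ℝ) (n : ℕ) (ω : ℝ≥0 → ℝ) : WithTop ℝ≥0 :=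
  min (sleSlopeReturnTime κ z L L₂ n ω) (sleCotArgLocTime κ z L₃ n ω)

/-- **The return event `Aₙ = {τ < C, υ ≤ C}`**: the slope reaches `±L₂` strictly before the cap
`C = T_{L₃} ∧ ρₙ` and returns to `|w| ≤ L` by time `C`. [folklore] -/
def sleSlopeReturnEvent (L L₂ L₃ : ℝ) (n : ℕ) : Set (ℝ≥0 → ℝ) :=
  {ω | sleCotArgLocTime κ z L₂ n ω < sleCotArgLocTime κ z L₃ n ω ∧
    sleSlopeReturnTime κ z L L₂ n ω ≤ sleCotArgLocTime κ z L₃ n ω}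

variable {κ z} {L L₂ L₃ : ℝ} {n : ℕ}

/-- `τ ≤ υ`. [folklore] -/
theorem sleCotArgLocTime_le_returnTime (ω : ℝ≥0 → ℝ) :
    sleCotArgLocTime κ z L₂ n ω ≤ sleSlopeReturnTime κ z L L₂ n ω := le_hittingFrom

/-- `τ ≤ υ ∧ C` (`L₂ ≤ L₃`). [folklore] -/
theorem sleCotArgLocTime_le_returnLocTime (h23 : L₂ ≤ L₃) (ω : ℝ≥0 → ℝ) :
    sleCotArgLocTime κ z L₂ n ω ≤ sleSlopeReturnLocTime κ z L L₂ L₃ n ω :=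
  le_min (sleCotArgLocTime_le_returnTime ω) (sleCotArgLocTime_mono_level h23 n ω)

/-- `υ ∧ C ≤ C`. [folklore] -/
theorem sleSlopeReturnLocTime_le (ω : ℝ≥0 → ℝ) :
    sleSlopeReturnLocTime κ z L L₂ L₃ n ω ≤ sleCotArgLocTime κ z L₃ n ω := min_le_right _ _

/-- `υ ∧ C ≤ n + 1`. [folklore] -/
theorem sleSlopeReturnLocTime_le_succ (ω : ℝ≥0 → ℝ) :
    sleSlopeReturnLocTime κ z L L₂ L₃ n ω ≤ (((n : ℝ≥0) + 1 : ℝ≥0) : WithTop ℝ≥0) :=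
  (sleSlopeReturnLocTime_le ω).trans (sleCotArgLocTime_le_succ L₃ n ω)

/-- **`υ` is a stopping time** of the raw Brownian filtration (hitting time of a closed set by a
continuous adapted process after a stopping time, `isStoppingTime_hittingFrom`). [folklore] -/
theorem isStoppingTime_sleSlopeReturnTime (hz : 0 < z.im) (L L₂ : ℝ) (n : ℕ) :
    IsStoppingTime brownianFiltration (sleSlopeReturnTime κ z L L₂ n) :=
  isStoppingTime_hittingFrom (adapted_sleSlopeGauge hz L n) (continuous_sleSlopeGauge hz L n)
    isClosed_Iic (isStoppingTime_sleCotArgLocTime hz L₂ n)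

/-- `υ ∧ C` is a stopping time. [folklore] -/
theorem isStoppingTime_sleSlopeReturnLocTime (hz : 0 < z.im) (L L₂ L₃ : ℝ) (n : ℕ) :
    IsStoppingTime brownianFiltration (sleSlopeReturnLocTime κ z L L₂ L₃ n) :=
  (isStoppingTime_sleSlopeReturnTime hz L L₂ n).min (isStoppingTime_sleCotArgLocTime hz L₃ n)

/-- **`Aₙ` is an event.** [folklore] -/
theorem measurableSet_sleSlopeReturnEvent (hz : 0 < z.im) (L L₂ L₃ : ℝ) (n : ℕ) :
    MeasurableSet (sleSlopeReturnEvent κ z L L₂ L₃ n) :=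
  (measurableSet_lt (isStoppingTime_sleCotArgLocTime (κ := κ) hz L₂ n).measurable'
      (isStoppingTime_sleCotArgLocTime (κ := κ) hz L₃ n).measurable').inter
    (measurableSet_le (isStoppingTime_sleSlopeReturnTime (κ := κ) hz L L₂ n).measurable'
      (isStoppingTime_sleCotArgLocTime (κ := κ) hz L₃ n).measurable')

/-- **At a return by time `C`, `|w_υ| ≤ L`** (the gauge is `≤ 0` at the attained hitting time
`υ ≤ C ≤ ρₙ`). [folklore] -/
theorem abs_cotArg_returnTime_le (hz : 0 < z.im) {ω : ℝ≥0 → ℝ} {u : ℝ≥0}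
    (hu : sleSlopeReturnTime κ z L L₂ n ω = u) (huρ : (u : WithTop ℝ≥0) ≤ slePointLocTime κ z n ω) :
    |cotArg (sleDriving κ ω) z u| ≤ L := by
  have hmem : sleSlopeGauge κ z L n u ω ∈ Iic (0 : ℝ) :=
    mem_of_hittingFrom_eq_coe isClosed_Iic (continuous_sleSlopeGauge hz L n ω) hu
  exact (sleSlopeGauge_nonpos_iff hz huρ).1 hmem

end Times

/-! ### Schramm's martingale `f(w_{t∧C}) - f(w₀)` -/

section Martingale

variable {L₃ : ℝ} {n : ℕ}

/-- **`f(w_{t ∧ C}) - f(w₀)` is a martingale with continuous paths** (`C = T_{L₃} ∧ ρₙ`,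
`|w₀| < L₃`, `κ > 0`): the tree's Itô decomposition `exists_martingale_slopeFunctional` with
`F = f = schrammScale κ`, `E ≡ 1`, `β ≡ 0`, whose drift `𝟙_{s≤C} y⁻² (A f)(w_s)` vanishes
identically by `A f = 0` (`slopeGen_schrammScale`). This is Schramm's "`h(w_u)` is a local
martingale … Itô's formula implies that the right hand side in (6) is a martingale" for the scale
function itself. [cite: Schramm2001Percolation, Thm. 2 (proof)] -/
theorem exists_martingale_schrammScale (hκ : 0 < κ) (hz : 0 < z.im) (h0 : |z.re / z.im| < L₃) (n : ℕ) :
    ∃ K : ℝ≥0 → (ℝ≥0 → ℝ) → ℝ, Martingale K brownianFiltration preWienerMeasure ∧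
      (∀ᵐ ω ∂preWienerMeasure, Continuous (K · ω)) ∧ (∀ ω, K 0 ω = 0) ∧
      ∀ᵐ ω ∂preWienerMeasure, ∀ t : ℝ≥0,
        K t ω = schrammScale κ (sleStopSlope κ z (sleCotArgLocTime κ z L₃ n) t ω) -
          schrammScale κ (z.re / z.im) := by
  have hC := isStoppingTime_sleCotArgLocTime (κ := κ) hz L₃ n
  have hCρ : ∀ ω, sleCotArgLocTime κ z L₃ n ω ≤ slePointLocTime κ z n ω :=
    sleCotArgLocTime_le_locTime L₃ n
  have hS : ∀ (ω : ℝ≥0 → ℝ) (t : ℝ≥0), (t : WithTop ℝ≥0) ≤ sleCotArgLocTime κ z L₃ n ω →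
      |cotArg (sleDriving κ ω) z t| ≤ L₃ := fun ω t ht ↦ abs_cotArg_le_of_le_sleCotArgLocTime hz h0 ht
  obtain ⟨K, hKM, hKc, hK0, hKeq⟩ := exists_martingale_slopeFunctional hz hC hCρ hS
    (contDiff_two_schrammScale κ) (E := fun _ _ ↦ (1 : ℝ)) (β := fun _ _ ↦ (0 : ℝ))
    (stronglyAdapted_const _ _) (fun _ ↦ continuous_const) (isStronglyProgressive_const _ _)
    (Cβ := 0) (fun _ _ ↦ by simp) (CE := 1) (fun _ _ ↦ by simp) (fun _ _ ↦ by simp)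
  refine ⟨K, hKM, hKc, hK0, ?_⟩
  filter_upwards [hKeq] with ω hω t
  have hdrift : ∀ s : ℝ, slopeFunctionalDrift κ z (sleCotArgLocTime κ z L₃ n) (schrammScale κ)
      (fun _ _ ↦ (1 : ℝ)) (fun _ _ ↦ (0 : ℝ)) s.toNNReal ω = 0 := fun s ↦ by
    rw [slopeFunctionalDrift_apply, trunc_apply]
    simp [slopeGen_schrammScale hκ]
  have h1 := hω t
  simp only [hdrift, intervalIntegral.integral_zero, add_zero, mul_one] at h1
  linarith

end Martingale

/-! ### An abstract form of the optional stopping inequality -/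

section Abstract

variable {Ω : Type*} [MeasurableSpace Ω] {μ : Measure Ω} [IsProbabilityMeasure μ]

/-- If `∫_G D = 0`, `D ≥ c₁ > 0` on `G ∩ A` and `D ≥ -c₂` on `G`, then `P(A ∩ G) ≤ c₂/(c₁ + c₂)`
(integrate `(c₁ + c₂) 𝟙_A ≤ D + c₂` over `G`). [folklore] -/
theorem measureReal_inter_le_of_setIntegral_eq_zero {G A : Set Ω} (hG : MeasurableSet G)
    (hA : MeasurableSet A) {D : Ω → ℝ} (hD : IntegrableOn D G μ) (h0 : ∫ ω in G, D ω ∂μ = 0)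
    {c₁ c₂ : ℝ} (hc₁ : 0 < c₁) (hc₂ : 0 ≤ c₂) (h1 : ∀ ω ∈ G ∩ A, c₁ ≤ D ω)
    (h2 : ∀ ω ∈ G, -c₂ ≤ D ω) : μ.real (A ∩ G) ≤ c₂ / (c₁ + c₂) := by
  have hpt : ∀ ω ∈ G, (c₁ + c₂) * A.indicator (1 : Ω → ℝ) ω ≤ D ω + c₂ := by
    intro ω hω
    by_cases hA' : ω ∈ A
    · rw [indicator_of_mem hA', Pi.one_apply, mul_one]
      linarith [h1 ω ⟨hω, hA'⟩]
    · rw [indicator_of_notMem hA', mul_zero]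
      linarith [h2 ω hω]
  have iL : IntegrableOn (fun ω ↦ (c₁ + c₂) * A.indicator (1 : Ω → ℝ) ω) G μ :=
    (((integrable_const (1 : ℝ)).indicator hA).const_mul (c₁ + c₂)).integrableOn
  have iR : IntegrableOn (fun ω ↦ D ω + c₂) G μ := hD.add (integrable_const c₂).integrableOn
  have hint := setIntegral_mono_on iL iR hG hpt
  rw [MeasureTheory.integral_const_mul, integral_indicator_one hA, measureReal_restrict_apply hA,
    integral_add hD (integrable_const c₂).integrableOn, h0, zero_add, setIntegral_const, smul_eq_mul] at hint
  have hG1 : μ.real G ≤ 1 := measureReal_le_one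
  have hc : 0 < c₁ + c₂ := by linarith
  rw [le_div_iff₀ hc]
  calc μ.real (A ∩ G) * (c₁ + c₂) = (c₁ + c₂) * μ.real (A ∩ G) := mul_comm _ _
    _ ≤ μ.real G * c₂ := hint
    _ ≤ 1 * c₂ := by gcongr
    _ = c₂ := one_mul _

end Abstract

/-! ### The return estimate -/

section Estimate

variable {L L₂ L₃ : ℝ} {n : ℕ}

/-- **The return estimate** (`0 < κ < 8`, `z ∈ ℍ`, `L < L₂ ≤ L₃`, `|w₀| < L₂`):
`P(Aₙ) = P[τ < C, υ ≤ C] ≤ 2 (f(∞) - f(L₂))/(f(∞) - f(L))`, uniformly in `n` and `L₃` — optional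
stopping of Schramm's martingale `f(w_{t∧C})` between `τ` and `υ ∧ C` on the `𝓕_τ`-events
`{τ < C, ±w_τ > 0}` (there `w_τ = ±L₂`; at a return `±w_{υ} ≤ L`; always `|f| ≤ f(∞)`). This is
Schramm's exit formula `P[w hits b before a] = (f(w) - f(a))/(f(b) - f(a))` at `w = L₂`, `a = L`,
`b → ∞`, as an inequality. [cite: Schramm2001Percolation, Thm. 2 (proof)] -/
theorem measureReal_sleSlopeReturnEvent_le (hκ : 0 < κ) (hκ8 : κ < 8) (hz : 0 < z.im)
    (hL : L < L₂) (h23 : L₂ ≤ L₃) (h0 : |z.re / z.im| < L₂) (n : ℕ) :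
    preWienerMeasure.real (sleSlopeReturnEvent κ z L L₂ L₃ n) ≤
      2 * ((schrammScaleSup κ - schrammScale κ L₂) / (schrammScaleSup κ - schrammScale κ L)) := by
  haveI := isProbabilityMeasure_preWienerMeasure'
  -- notation
  set f : ℝ → ℝ := schrammScale κ with hf
  set S : ℝ := schrammScaleSup κ with hSdef
  set C : (ℝ≥0 → ℝ) → WithTop ℝ≥0 := sleCotArgLocTime κ z L₃ n with hCdef
  set τ : (ℝ≥0 → ℝ) → WithTop ℝ≥0 := sleCotArgLocTime κ z L₂ n with hτdef
  set σ : (ℝ≥0 → ℝ) → WithTop ℝ≥0 := sleSlopeReturnLocTime κ z L L₂ L₃ n with hσdef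
  set A : Set (ℝ≥0 → ℝ) := sleSlopeReturnEvent κ z L L₂ L₃ n with hAdef
  set X : ℝ≥0 → (ℝ≥0 → ℝ) → ℝ := sleStopSlope κ z C with hXdef
  have h03 : |z.re / z.im| < L₃ := lt_of_lt_of_le h0 h23
  have hC : IsStoppingTime brownianFiltration C := isStoppingTime_sleCotArgLocTime hz L₃ n
  have hτ : IsStoppingTime brownianFiltration τ := isStoppingTime_sleCotArgLocTime hz L₂ n
  have hσ : IsStoppingTime brownianFiltration σ := isStoppingTime_sleSlopeReturnLocTime hz L L₂ L₃ n
  have hCρ : ∀ ω, C ω ≤ slePointLocTime κ z n ω := sleCotArgLocTime_le_locTime L₃ n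
  have hτC : ∀ ω, τ ω ≤ C ω := fun ω ↦ sleCotArgLocTime_mono_level h23 n ω
  have hτσ : ∀ ω, τ ω ≤ σ ω := fun ω ↦ sleCotArgLocTime_le_returnLocTime h23 ω
  have hσC : ∀ ω, σ ω ≤ C ω := fun ω ↦ sleSlopeReturnLocTime_le ω
  have hσN : ∀ ω, σ ω ≤ (((n : ℝ≥0) + 1 : ℝ≥0) : WithTop ℝ≥0) := fun ω ↦ sleSlopeReturnLocTime_le_succ ω
  have hτN : ∀ ω, τ ω ≤ (((n : ℝ≥0) + 1 : ℝ≥0) : WithTop ℝ≥0) := fun ω ↦ (hτσ ω).trans (hσN ω)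
  have hAm : MeasurableSet A := measurableSet_sleSlopeReturnEvent hz L L₂ L₃ n
  -- constants
  have hS0 : ∀ v, |f v| ≤ S := fun v ↦ abs_schrammScale_le_sup hκ hκ8 v
  have hfmono : StrictMono f := strictMono_schrammScale κ
  set c₁ : ℝ := f L₂ - f L with hc₁
  set c₂ : ℝ := S - f L₂ with hc₂
  have hc₁pos : 0 < c₁ := by rw [hc₁]; linarith [hfmono hL]
  have hc₂nn : 0 ≤ c₂ := by rw [hc₂]; linarith [(abs_le.1 (hS0 L₂)).2]
  have hsum : c₁ + c₂ = S - f L := by rw [hc₁, hc₂]; ring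
  -- the martingale
  obtain ⟨K, hKM, hKc, hK0, hKeq⟩ := exists_martingale_schrammScale (L₃ := L₃) hκ hz h03 n
  -- the pathwise difference `D = f(w_τ) - f(w_σ)` and its a.e. identification with `K_τ - K_σ`
  set D : (ℝ≥0 → ℝ) → ℝ := fun ω ↦ f (X (τ ω).untopA ω) - f (X (σ ω).untopA ω) with hD
  have hDae : D =ᵐ[preWienerMeasure] fun ω ↦ -(K (σ ω).untopA ω - K (τ ω).untopA ω) := by
    filter_upwards [hKeq] with ω hω
    simp only [hD, hω]
    ring
  have hDint : Integrable D preWienerMeasure := by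
    refine Integrable.congr ?_ hDae.symm
    exact ((integrable_stoppedValue_of_martingale hKM hKc hσ hσN).sub
      (integrable_stoppedValue_of_martingale hKM hKc hτ hτN)).neg
  have hD0 : ∀ {G : Set (ℝ≥0 → ℝ)}, MeasurableSet[hτ.measurableSpace] G →
      ∫ ω in G, D ω ∂preWienerMeasure = 0 := by
    intro G hG
    have h := setIntegral_stoppedValue_sub_eq_zero hKM hKc hK0 hτ hσ hτσ hσN hG
    rw [setIntegral_congr_ae (hτ.measurableSpace_le _ hG) (hDae.mono fun ω h _ ↦ h),
      MeasureTheory.integral_neg, h, neg_zero]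
  -- pathwise values
  have hXval : ∀ (ω : ℝ≥0 → ℝ) {T : WithTop ℝ≥0}, T ≤ C ω →
      X T.untopA ω = cotArg (sleDriving κ ω) z T.untopA := by
    intro ω T hT
    have hT' : T ≠ ⊤ := ne_top_of_le_ne_top (sleCotArgLocTime_ne_top L₃ n ω) hT
    rw [hXdef, sleStopSlope_eq_cotArg hz hCρ]
    congr 1
    rw [min_eq_left (by rw [WithTop.untopA_eq_untop hT', WithTop.coe_untop]; exact hT)]
    rfl
  -- on `{τ < C}`: `|w_τ| = L₂`
  have hτval : ∀ ω, τ ω < C ω → |X (τ ω).untopA ω| = L₂ := by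
    intro ω hlt
    rw [hXval ω (hτC ω)]
    exact abs_cotArg_untopA_sleCotArgLocTime hz h0 (hlt.trans_le (hCρ ω))
  -- on `A`: `|w_σ| ≤ L`
  have hσval : ∀ ω ∈ A, |X (σ ω).untopA ω| ≤ L := by
    intro ω hω
    have hυC : sleSlopeReturnTime κ z L L₂ n ω ≤ C ω := hω.2
    have hσeq : σ ω = sleSlopeReturnTime κ z L L₂ n ω := min_eq_left hυC
    have hne : sleSlopeReturnTime κ z L L₂ n ω ≠ ⊤ :=
      ne_top_of_le_ne_top (sleCotArgLocTime_ne_top L₃ n ω) hυC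
    obtain ⟨u, hu⟩ := WithTop.ne_top_iff_exists.1 hne
    have hu' : sleSlopeReturnTime κ z L L₂ n ω = u := hu.symm
    have huC : (u : WithTop ℝ≥0) ≤ C ω := hu ▸ hυC
    rw [hXval ω (hσC ω), hσeq, hu']
    exact abs_cotArg_returnTime_le hz hu' (huC.trans (hCρ ω))
  -- the two `𝓕_τ`-events
  have hXprog : IsStronglyProgressive brownianFiltration X := isStronglyProgressive_sleStopSlope hz hC hCρ
  have hXτ : Measurable[hτ.measurableSpace] (stoppedValue X τ) := measurable_stoppedValue hXprog hτ
  have hlt : MeasurableSet[hτ.measurableSpace] {ω | τ ω < C ω} := by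
    have h := IsStoppingTime.measurableSet_stopping_time_le hC hτ
    have heq : {ω | τ ω < C ω} = {ω | C ω ≤ τ ω}ᶜ := by ext ω; simp [not_le]
    rw [heq]
    exact h.compl
  have hGp : MeasurableSet[hτ.measurableSpace] ({ω | τ ω < C ω} ∩ {ω | 0 < stoppedValue X τ ω}) :=
    hlt.inter (measurableSet_lt measurable_const hXτ)
  have hGm : MeasurableSet[hτ.measurableSpace] ({ω | τ ω < C ω} ∩ {ω | stoppedValue X τ ω < 0}) :=
    hlt.inter (measurableSet_lt hXτ measurable_const)
  -- `A ⊆ G₊ ∪ G₋`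
  have hAsub : A ⊆ ({ω | τ ω < C ω} ∩ {ω | 0 < stoppedValue X τ ω}) ∪
      ({ω | τ ω < C ω} ∩ {ω | stoppedValue X τ ω < 0}) := by
    intro ω hω
    have hne : stoppedValue X τ ω ≠ 0 := by
      intro h0'
      have := hτval ω hω.1
      rw [stoppedValue] at h0'
      rw [h0', abs_zero] at this
      linarith [abs_nonneg (z.re / z.im)]
    rcases lt_or_gt_of_ne hne with h | h
    · exact Or.inr ⟨hω.1, h⟩
    · exact Or.inl ⟨hω.1, h⟩
  -- estimate on `G₊`
  have hP : preWienerMeasure.real (A ∩ ({ω | τ ω < C ω} ∩ {ω | 0 < stoppedValue X τ ω})) ≤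
      c₂ / (c₁ + c₂) := by
    refine measureReal_inter_le_of_setIntegral_eq_zero (hτ.measurableSpace_le _ hGp) hAm
      hDint.integrableOn (hD0 hGp) hc₁pos hc₂nn ?_ ?_
    · rintro ω ⟨⟨hlt', hpos⟩, hA⟩
      have h1 : X (τ ω).untopA ω = L₂ := by
        have := hτval ω hlt'
        rw [abs_of_pos (by exact hpos)] at this
        exact this
      have h2 : X (σ ω).untopA ω ≤ L := (le_abs_self _).trans (hσval ω hA)
      simp only [hD, h1]
      linarith [hfmono.monotone h2]
    · rintro ω ⟨hlt', hpos⟩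
      have h1 : X (τ ω).untopA ω = L₂ := by
        have := hτval ω hlt'
        rw [abs_of_pos (by exact hpos)] at this
        exact this
      simp only [hD, h1]
      linarith [(abs_le.1 (hS0 (X (σ ω).untopA ω))).2]
  -- estimate on `G₋` (with `-D`)
  have hM : preWienerMeasure.real (A ∩ ({ω | τ ω < C ω} ∩ {ω | stoppedValue X τ ω < 0})) ≤
      c₂ / (c₁ + c₂) := by
    refine measureReal_inter_le_of_setIntegral_eq_zero (hτ.measurableSpace_le _ hGm) hAm
      hDint.neg.integrableOn
      (by simp only [Pi.neg_apply]; rw [MeasureTheory.integral_neg, hD0 hGm, neg_zero]) hc₁pos hc₂nn ?_ ?_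
    · rintro ω ⟨⟨hlt', hneg⟩, hA⟩
      have h1 : X (τ ω).untopA ω = -L₂ := by
        have := hτval ω hlt'
        rw [abs_of_neg (by exact hneg)] at this
        linarith
      have h2 : -L ≤ X (σ ω).untopA ω := (abs_le.1 (hσval ω hA)).1
      simp only [Pi.neg_apply, hD, h1]
      have h3 : f (-L) ≤ f (X (σ ω).untopA ω) := hfmono.monotone h2
      have h4 : f (-L₂) = -f L₂ := schrammScale_neg κ L₂
      have h5 : f (-L) = -f L := schrammScale_neg κ L
      linarith
    · rintro ω ⟨hlt', hneg⟩
      have h1 : X (τ ω).untopA ω = -L₂ := by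
        have := hτval ω hlt'
        rw [abs_of_neg (by exact hneg)] at this
        linarith
      simp only [Pi.neg_apply, hD, h1]
      have h4 : f (-L₂) = -f L₂ := schrammScale_neg κ L₂
      linarith [(abs_le.1 (hS0 (X (σ ω).untopA ω))).1]
  -- assemble
  have hratio : c₂ / (c₁ + c₂) = (S - f L₂) / (S - f L) := by rw [hsum]
  calc preWienerMeasure.real A
      ≤ preWienerMeasure.real (A ∩ ({ω | τ ω < C ω} ∩ {ω | 0 < stoppedValue X τ ω}) ∪
          A ∩ ({ω | τ ω < C ω} ∩ {ω | stoppedValue X τ ω < 0})) := by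
        refine measureReal_mono (fun ω hω ↦ ?_)
        rcases hAsub hω with h | h
        · exact Or.inl ⟨hω, h⟩
        · exact Or.inr ⟨hω, h⟩
    _ ≤ preWienerMeasure.real (A ∩ ({ω | τ ω < C ω} ∩ {ω | 0 < stoppedValue X τ ω})) +
          preWienerMeasure.real (A ∩ ({ω | τ ω < C ω} ∩ {ω | stoppedValue X τ ω < 0})) :=
        measureReal_union_le _ _
    _ ≤ c₂ / (c₁ + c₂) + c₂ / (c₁ + c₂) := add_le_add hP hM
    _ = 2 * ((S - f L₂) / (S - f L)) := by rw [hratio]; ring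

end Estimate

end Literature.Probability.RandomPlanarGeometry
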